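import Summits.HodgeConjecture.HodgeConjecture.Theorems.Ring2AbelianAllAndreInvariantHomNumRank
import Summits.HodgeConjecture.HodgeConjecture.Theorems.Ring2AbelianAllAndreSpreadVerdier
import HarnessLib

/-!
# Ring 2 · sub-cell AbelianAll (ALL ABELIAN VARIETIES), André axis, part XXX-f — EXACTNESS ROWS for the forms of part XXX:
# `HC_AV ⟺ HC_CM ∧ Num^{CM,inv}`, `HC_AV ⟺ HC_CM ∧ Det^CM`, `HC_AV ⟺ HC_CM ∧ [one rank inequality per (pencil, CM point, degree)]`,
# all modulo [Lemme 6.3.1, Verdier] — Num^{CM,inv} and Det^CM are EXACT, `HC_CM`-idle complements like (L); the HODGE rank form of §2 is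
# exact too but is a PIVOT (it implies `HC_CM` on constant pencils: ab-spread-1 part XXXI `HC_CM_of_finrank_hodge_le`, REFEREE-AB F-ab-122)

HONEST FRAMING (page 1, verbatim): **research route, not a corollary; conditional on HC_CM plus one named
minimal statement.** Cell line: research route conditional on HC_CM; not a corollary; Q11.4-sentence-2
already refuted in dim ≥ 3. Nothing in this file proves a case of the Hodge conjecture for an abelian variety.
`HC_CM` = `Theses.RankFourFaces.CMAbelianHodge` occurs INSIDE the equivalences (as a conjunct) and as a binder; `HC_AV` =
`Theses.PadicSemiregularLift.HodgeAbelianVarieties`; `h₂₁` = André's Lemme 6.3.1 (`andre1996_cmAnchoredPencil`) and `hGT` = Verdier's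
generic local triviality (`Verdier1976_genericLocalTriviality`) are NAMED-FACT BINDERS (Literature `def … : Prop`, taken as hypotheses, not
discharged here); item `Theses.RankFourFaces.CMToAbelian` (stmt-HodgeConjecture-16267) OPEN and not closed here — §3 gives its reading.
Seat `pub-hodge-ring2-ab-andre-2`, gen 22; brief (i)/(ii) ("state competing candidates and prove the implications between them").
Sequel of parts XXX-a…d and of part XI (`Ring2AbelianAllAndreSpreadVerdier`: `HC_AV ⟺ HC_CM ∧ (L)` mod [h₂₁, Verdier]).

## What is proved (theorems only; no definition, no named fact, no sorry)

§1 **`HC_AV_iff_HC_CM_and_numericalInvCM_of_verdier`** — `HC_AV ⟺ HC_CM ∧ Num^{CM,inv}` (part XI's exactness of (L) + part XXX-b's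
`(L) ⟺ Num^{CM,inv}`); **`HC_AV_iff_HC_CM_and_detectCM_of_verdier`** — `HC_AV ⟺ HC_CM ∧ Det^CM` ("at every CM point of every compact
abelian pencil every non-zero invariant algebraic class of degree `2q` has non-zero intersection number with the restriction of some
global algebraic class of codimension `p = d - q`"). §2 **`HC_AV_iff_HC_CM_and_finrank_of_verdier`** — `HC_AV ⟺ HC_CM ∧ [∀ pencils, CM
points `t`, degrees `p`: `dim ((Hdg^p(X_t) ⊗ ℂ) ∩ Im j_t^*) ≤ dim j_t^* N^p(𝒳)`]` (part XXX-d's rank form). §3 the item readings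
`cmToAbelian_iff_HC_CM_imp_numericalInvCM_of_verdier`, `cmToAbelian_iff_HC_CM_imp_finrank_of_verdier`. All modulo [h₂₁, hGT]; nothing
closes the item; nothing is claimed minimal; no node is born.

References: Andre1996Motifs (Lemme 6.3.1 p. 31, §6.3 a) and Remarque 2 p. 33); Verdier1976 (Cor. 5.1); Kleiman1968AlgebraicCycles (§3 (D(X)));
Lieberman1968 (main theorem); Milne2020HodgeClassesAV (Prop. 1 p. 7); DeligneHodgeII1971 (Thm. 4.1.1).
-/

noncomputable section

set_option linter.dupNamespace false

namespace Summit.HodgeConjecture.HodgeConjecture.Ring2.AbelianAll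

open CategoryTheory AlgebraicGeometry
open Literature.AlgebraicGeometry Literature.AlgebraicGeometry.Motives
open Literature.AlgebraicGeometry.HodgeTheory
open Literature.AlgebraicTopology.SingularHomology (singularCohomology cupProduct)
open Literature.AlgebraicGeometry.Deligne1982 (cmLocus)
open Literature.AlgebraicGeometry.Andre1996 (andre1996_cmAnchoredPencil)
open Summit.HodgeConjecture.HodgeConjecture.Theses
open Summit.HodgeConjecture.HodgeConjecture.Ring2.Deform (HC_CM_of_HC_AV)

/-! ## §1 `HC_AV ⟺ HC_CM ∧ Num^{CM,inv}` and `HC_AV ⟺ HC_CM ∧ Det^CM`, modulo [Lemme 6.3.1, Verdier] -/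

/-- **EXACTNESS OF Num^{CM,inv}: `HC_AV ⟺ HC_CM ∧ [at every CM point of every compact abelian pencil, `p + q = d`, an invariant algebraic
`b ∈ N^q(X_t) ∩ Im j_t^*` with `a ∪ j_{t*} b = 0` for all `a ∈ N^p(𝒳)` has `j_{t*} b = 0`]`**, granted André's Lemme 6.3.1 (`h₂₁`) and Verdier's
generic local triviality (`hGT`) — part XI's `HC_AV ⟺ HC_CM ∧ (L)` with part XXX-b's `(L) ⟺ Num^{CM,inv}`. `HC_CM` is inside the `↔`;
`h₂₁`, `hGT` are named-fact binders. research route, not a corollary; conditional on HC_CM plus one named minimal statement.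
[cite: Andre1996Motifs, Lemme 6.3.1 (p. 31) and Remarque 2 (p. 33)] [cite: Verdier1976, Cor. 5.1] [cite: Kleiman1968AlgebraicCycles, §3 (D(X))] -/
theorem HC_AV_iff_HC_CM_and_numericalInvCM_of_verdier (h₂₁ : andre1996_cmAnchoredPencil)
    (hGT : Verdier1976_genericLocalTriviality) :
    PadicSemiregularLift.HodgeAbelianVarieties ↔ (RankFourFaces.CMAbelianHodge ∧
      ∀ ⦃d : ℕ⦄ ⦃𝒳 S : SchemeOver ℂ⦄ (f : 𝒳 ⟶ S) (hf : IsCompactAbelianPencil f d) (t : ComplexPoints S),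
        t ∈ cmLocus f d → ∀ (p q : ℕ) (hpq : p + q = d),
          ∀ b ∈ algebraicClasses (fiberOver f t) q ⊓ LinearMap.range (complexBetti.map (fiberι f t) (2 * q)).hom,
            (∀ a ∈ algebraicClasses 𝒳 p,
              cupProduct (show 2 * p + 2 * (q + 1) = 2 * (d + 1) by omega) a (fiberGysin hf t q b) = 0) →
              fiberGysin hf t q b = 0) := by
  rw [HC_AV_iff_HC_CM_and_cmFibreAlgebraicLift_of_verdier h₂₁ hGT, cmFibreAlgebraicLift_iff_numericalInvCM]

/-- **EXACTNESS OF Det^CM: `HC_AV ⟺ HC_CM ∧ [at every CM point of every compact abelian pencil, `p + q = d`, every NON-ZERO invariant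
algebraic class `b` of degree `2q` on the fibre is numerically detected by a global algebraic class: `j_t^* a ∪ b ≠ 0` for some
`a ∈ N^p(𝒳)`]`** (part XXX-a's find-the-cycle form of the lift), granted `h₂₁` and `hGT`. `HC_CM` inside the `↔`; `h₂₁`, `hGT` binders.
research route, not a corollary; conditional on HC_CM plus one named minimal statement. [cite: Andre1996Motifs, Lemme 6.3.1 (p. 31)]
[cite: Verdier1976, Cor. 5.1] [cite: Kleiman1968AlgebraicCycles, §3 (D(X))] -/
theorem HC_AV_iff_HC_CM_and_detectCM_of_verdier (h₂₁ : andre1996_cmAnchoredPencil)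
    (hGT : Verdier1976_genericLocalTriviality) :
    PadicSemiregularLift.HodgeAbelianVarieties ↔ (RankFourFaces.CMAbelianHodge ∧
      ∀ ⦃d : ℕ⦄ ⦃𝒳 S : SchemeOver ℂ⦄ (f : 𝒳 ⟶ S) (hf : IsCompactAbelianPencil f d) (t : ComplexPoints S),
        t ∈ cmLocus f d → ∀ (p q : ℕ) (hpq : p + q = d),
          ∀ b ∈ algebraicClasses (fiberOver f t) q ⊓ LinearMap.range (complexBetti.map (fiberι f t) (2 * q)).hom, b ≠ 0 →
            ∃ a ∈ algebraicClasses 𝒳 p,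
              cupProduct (show 2 * p + 2 * q = 2 * d by omega) (complexBetti.map (fiberι f t) (2 * p) a) b ≠ 0) := by
  rw [HC_AV_iff_HC_CM_and_cmFibreAlgebraicLift_of_verdier h₂₁ hGT, cmFibreAlgebraicLift_iff_comap_le_sup]
  refine and_congr Iff.rfl ⟨fun h d 𝒳 S f hf t ht p q hpq ↦ (comap_le_sup_iff_detect hf t hpq).1 (h f hf p t ht),
    fun h d 𝒳 S f hf p t ht ↦ ?_⟩
  rcases le_or_gt p d with hp | hp
  · exact (comap_le_sup_iff_detect hf t (show p + (d - p) = d by omega)).2 (h f hf t ht p (d - p) (by omega))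
  · haveI := subsingleton_complexBetti (hf.isSmoothProjective_fiberOver t) (show 2 * d < 2 * p by omega)
    intro W _
    refine Submodule.mem_sup_right ?_
    rw [LinearMap.mem_ker]
    exact Subsingleton.elim _ _

/-! ## §2 `HC_AV ⟺ HC_CM ∧ [rank inequalities]`, modulo [Lemme 6.3.1, Verdier] -/

/-- **EXACTNESS OF THE RANK FORM: `HC_AV ⟺ HC_CM ∧ [at every CM point `t` of every compact abelian pencil and in every degree `2p`,
`dim ((Hdg^p(X_t) ⊗ ℂ) ∩ Im j_t^*) ≤ dim j_t^* N^p(𝒳)`]`**, granted `h₂₁` and `hGT` (part XI's exactness of (L) with part XXX-d's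
`comap_le_sup_iff_finrank_hodge_le_of_HC_CM`; in the `⟹` direction `HC_CM` — a consequence of `HC_AV` — converts invariant algebraic classes
into invariant Hodge classes). `HC_CM` inside the `↔`; `h₂₁`, `hGT` binders. (Rev. 2, REFEREE-AB F-ab-122: the `HC_CM ∧` conjunct is
REDUNDANT here — the Hodge rank form implies `HC_CM` on constant pencils, ab-spread-1 part XXXI `HC_CM_of_finrank_hodge_le` /
`HC_AV_iff_finrank_hodge_le_of_verdier`; so this form is a pivot, not an `HC_CM`-idle complement.) research route, not a corollary; conditional on HC_CM plus one named
minimal statement. [cite: Andre1996Motifs, Lemme 6.3.1 (p. 31) and §6.3 a) (p. 33)] [cite: Verdier1976, Cor. 5.1] [cite: Milne2020HodgeClassesAV, Prop. 1 (p. 7)] -/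
theorem HC_AV_iff_HC_CM_and_finrank_of_verdier (h₂₁ : andre1996_cmAnchoredPencil)
    (hGT : Verdier1976_genericLocalTriviality) :
    PadicSemiregularLift.HodgeAbelianVarieties ↔ (RankFourFaces.CMAbelianHodge ∧
      ∀ ⦃d : ℕ⦄ ⦃𝒳 S : SchemeOver ℂ⦄ (f : 𝒳 ⟶ S), IsCompactAbelianPencil f d → ∀ (p : ℕ), ∀ t ∈ cmLocus f d,
        Module.finrank ℂ ↥(Submodule.span ℂ {c : complexBetti (fiberOver f t) (2 * p) |
              IsRationalClass c ∧ IsOfHodgeType d (fiberOver f t) (2 * p) p p c} ⊓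
            LinearMap.range (complexBetti.map (fiberι f t) (2 * p)).hom) ≤
          Module.finrank ℂ ↥((algebraicClasses 𝒳 p).map (complexBetti.map (fiberι f t) (2 * p)).hom)) := by
  refine ⟨fun h ↦ ⟨HC_CM_of_HC_AV h, fun d 𝒳 S f hf p t ht ↦ ?_⟩, fun h ↦ HC_AV_of_HC_CM_of_finrank h₂₁ h.1 h.2⟩
  exact (comap_le_sup_iff_finrank_hodge_le_of_HC_CM (HC_CM_of_HC_AV h) hf p ht).1
    (cmFibreAlgebraicLift_iff_comap_le_sup.1 (cmFibreAlgebraicLift_of_HC_AV_of_verdier hGT h) f hf p t ht)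

/-! ## §3 The item readings -/

/-- **The item `CMToAbelian` (= `HC_CM → HC_AV`) reads, modulo [h₂₁, hGT]: `HC_CM → Num^{CM,inv}`.** Nothing closes the item.
[cite: Andre1996Motifs, Remarque 2 (p. 33)] [cite: Verdier1976, Cor. 5.1] -/
theorem cmToAbelian_iff_HC_CM_imp_numericalInvCM_of_verdier (h₂₁ : andre1996_cmAnchoredPencil)
    (hGT : Verdier1976_genericLocalTriviality) :
    RankFourFaces.CMToAbelian ↔ (RankFourFaces.CMAbelianHodge →
      ∀ ⦃d : ℕ⦄ ⦃𝒳 S : SchemeOver ℂ⦄ (f : 𝒳 ⟶ S) (hf : IsCompactAbelianPencil f d) (t : ComplexPoints S),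
        t ∈ cmLocus f d → ∀ (p q : ℕ) (hpq : p + q = d),
          ∀ b ∈ algebraicClasses (fiberOver f t) q ⊓ LinearMap.range (complexBetti.map (fiberι f t) (2 * q)).hom,
            (∀ a ∈ algebraicClasses 𝒳 p,
              cupProduct (show 2 * p + 2 * (q + 1) = 2 * (d + 1) by omega) a (fiberGysin hf t q b) = 0) →
              fiberGysin hf t q b = 0) := by
  rw [cmToAbelian_iff_HC_CM_imp_cmFibreAlgebraicLift_of_verdier h₂₁ hGT, cmFibreAlgebraicLift_iff_numericalInvCM]

/-- **The item `CMToAbelian` reads, modulo [h₂₁, hGT]: `HC_CM →` [the rank inequalities at the CM points].** Nothing closes the item.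
[cite: Andre1996Motifs, Remarque 2 (p. 33)] [cite: Verdier1976, Cor. 5.1] -/
theorem cmToAbelian_iff_HC_CM_imp_finrank_of_verdier (h₂₁ : andre1996_cmAnchoredPencil)
    (hGT : Verdier1976_genericLocalTriviality) :
    RankFourFaces.CMToAbelian ↔ (RankFourFaces.CMAbelianHodge →
      ∀ ⦃d : ℕ⦄ ⦃𝒳 S : SchemeOver ℂ⦄ (f : 𝒳 ⟶ S), IsCompactAbelianPencil f d → ∀ (p : ℕ), ∀ t ∈ cmLocus f d,
        Module.finrank ℂ ↥(Submodule.span ℂ {c : complexBetti (fiberOver f t) (2 * p) |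
              IsRationalClass c ∧ IsOfHodgeType d (fiberOver f t) (2 * p) p p c} ⊓
            LinearMap.range (complexBetti.map (fiberι f t) (2 * p)).hom) ≤
          Module.finrank ℂ ↥((algebraicClasses 𝒳 p).map (complexBetti.map (fiberι f t) (2 * p)).hom)) := by
  rw [cmToAbelian_iff_HC_CM_imp_cmFibreAlgebraicLift_of_verdier h₂₁ hGT]
  refine ⟨fun h hCM d 𝒳 S f hf p t ht ↦ ?_, fun h hCM ↦ ?_⟩
  · exact (comap_le_sup_iff_finrank_hodge_le_of_HC_CM hCM hf p ht).1 (cmFibreAlgebraicLift_iff_comap_le_sup.1 (h hCM) f hf p t ht)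
  · exact cmFibreAlgebraicLift_iff_comap_le_sup.2 fun _ _ _ f hf p t ht ↦
      (comap_le_sup_iff_finrank_hodge_le_of_HC_CM hCM hf p ht).2 (h hCM f hf p t ht)

end Summit.HodgeConjecture.HodgeConjecture.Ring2.AbelianAll

end
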